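import Literature.Computability.MetaComplexity.AffineClauseSystems
import Literature.Computability.MetaComplexity.ResLinWidth
import Literature.Computability.MetaComplexity.ResLinProofs
import Literature.Computability.MetaComplexity.ScopeExpansion
import Literature.Computability.MetaComplexity.TseitinLiftProofs

/-!
# PneNP / ReslinSizeFromWidth — from a minimally implying clause set to the rank of a linear
clause (helper for stmt-PneNP-18934)

Route `PneNP/ReslinSizeFromWidth`, support item stmt-PneNP-18934 (`WidthFromVertexExpansion`).
This file transports the tree's Res(⊕) objects (`LinClause`, `linClauseRank`, `Clause.eval`,
`clauseScope`/`cnfScopes`, `cover`) into the affine-system vocabulary of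
`Literature.Computability.MetaComplexity.AffineClauseSystems` on a finite window `N ⊆ ℕ` of
variables (the DICTIONARY used by the affine Claim 18.22, `ResLinRank.card_cover_succ_le`, in
the closing file): encodings `zOf`, `σOf` (Boolean `σ` ↔ `𝔽₂`-vector on `N`), `restrictN`
(forms cut down to `N`), `negSys` (the system `¬C`: equations `f = a + 1` for the disjuncts
`(f = a)` of `C`), `scopeN`, `pattern` (the unique falsifying pattern of a non-tautological
clause), with: `zOf σ ∈ Sol (negSys N C) ↔ C.eval σ = false`, satisfaction of a clause ↔
differing from its pattern on its scope, `⋃ scopeN = cover` on the window, and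
`dim ⟨L(negSys N C)⟩ ≤ linClauseRank C` (`Submodule.finrank_map_le`).

References: S. Jukna, *Boolean Function Complexity* (2012), §18.8, Claim 18.22 (resolution
version); D. Itsykson, D. Sokolov, APAL 171 (2020), §2 (Res(⊕)); K. Efremenko, M. Garlík,
D. Itsykson, STOC 2024, §2.1–2.2 (`L(C)`, `rk(¬C)`).
-/

namespace Summit.PneNP.PneNP.Theorems

-- `Summit.PneNP.PneNP` repeats a path component by design (summit = sub-problem); silence the linter.
set_option linter.dupNamespace false

namespace ResLinRank

open Finset Module Literature.Computability.Complexity Literature.Computability.MetaComplexity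
open Literature.Computability.MetaComplexity.AffSys

/-! ### Encodings on a finite window `N ⊆ ℕ` of variables -/

/-- A Boolean assignment as an `𝔽₂`-vector on the window `N` (`true ↦ 1`, `false ↦ 0`). -/
def zOf (N : Finset ℕ) (σ : ℕ → Bool) : ↥N → ZMod 2 := fun v => if σ v.1 = true then 1 else 0

/-- An `𝔽₂`-vector on the window as a Boolean assignment (`false` outside the window). -/
def σOf (N : Finset ℕ) (z : ↥N → ZMod 2) : ℕ → Bool :=
  fun v => if h : v ∈ N then decide (z ⟨v, h⟩ = 1) else false

/-- Restriction of (coefficient vectors of) linear forms to the window. -/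
def restrictN (N : Finset ℕ) : (ℕ → ZMod 2) →ₗ[ZMod 2] (↥N → ZMod 2) :=
  LinearMap.funLeft (ZMod 2) (ZMod 2) (Subtype.val : ↥N → ℕ)

/-- The affine system `¬C` on the window: one equation `f = a + 1` per disjunct `(f = a)` of the
linear clause `C` (a literal `(f, b)` is FALSE at `σ` iff the parity of `σ` on `f` is `¬b`). -/
def negSys (N : Finset ℕ) (C : LinClause) : AffSys ↥N :=
  C.image fun l => (restrictN N (linFormVec l.1), if l.2 = true then 0 else 1)

/-- The scope of the `i`-th clause of `φ`, cut down to the window. -/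
def scopeN (N : Finset ℕ) (φ : CNF ℕ) (i : Fin φ.length) : Finset ↥N :=
  (clauseScope φ[i]).subtype (· ∈ N)

/-- The forbidden pattern of the `i`-th clause of `φ` on the window: the unique assignment of its
variables falsifying it (`0` under a positive literal, `1` under a negative one; meaningful for
non-tautological clauses). -/
def pattern (N : Finset ℕ) (φ : CNF ℕ) (i : Fin φ.length) : ↥N → ZMod 2 :=
  fun v => if ((v.1, true) : Literal ℕ) ∈ φ[i] then 0 else 1

/-! ### The dictionary -/

/-- Round trip: every `𝔽₂`-vector on the window comes from its Boolean assignment. -/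
theorem zOf_σOf (N : Finset ℕ) (z : ↥N → ZMod 2) : zOf N (σOf N z) = z := by
  funext v
  have h2 : ∀ x : ZMod 2, x = 0 ∨ x = 1 := by decide
  simp only [zOf, σOf, dif_pos v.2, decide_eq_true_eq]
  rcases h2 (z v) with h | h
  · rw [h, if_neg (by decide)]
  · rw [h, if_pos rfl]

/-- The parity computation: on the window, `⟨f, zOf σ⟩` is the number of true variables of `f`
(mod 2), for `f ⊆ N`. -/
theorem restrictN_linFormVec_dotProduct_zOf {N f : Finset ℕ} (hf : f ⊆ N) (σ : ℕ → Bool) :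
    restrictN N (linFormVec f) ⬝ᵥ zOf N σ = ((f.filter fun i => σ i = true).card : ZMod 2) := by
  classical
  unfold dotProduct
  have h1 : ∀ v : ↥N, restrictN N (linFormVec f) v * zOf N σ v =
      (if (v.1 ∈ f ∧ σ v.1 = true) then (1 : ZMod 2) else 0) := by
    intro v
    simp only [restrictN, LinearMap.funLeft_apply, linFormVec_apply, zOf]
    by_cases ha : v.1 ∈ f <;> by_cases hb : σ v.1 = true <;> simp [ha, hb]
  rw [Finset.sum_congr rfl (fun v _ => h1 v)]
  rw [Finset.sum_coe_sort N (fun i : ℕ => if (i ∈ f ∧ σ i = true) then (1 : ZMod 2) else 0)]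
  rw [Finset.sum_boole]
  congr 2
  ext i
  simp only [Finset.mem_filter]
  constructor
  · rintro ⟨-, hi, hσ⟩; exact ⟨hi, hσ⟩
  · rintro ⟨hi, hσ⟩; exact ⟨hf hi, hi, hσ⟩

/-- A linear literal `(f = b)` is FALSE at `σ` iff the parity of `σ` on `f` is `b + 1`. -/
theorem linLit_eval_eq_false_iff (σ : ℕ → Bool) (f : Finset ℕ) (b : Bool) :
    LinLit.eval σ (f, b) = false ↔
      (((f.filter fun i => σ i = true).card : ℕ) : ZMod 2) = (if b = true then 0 else 1) := by
  rw [LinLit.eval]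
  simp only [decide_eq_false_iff_not]
  set n := (f.filter fun i => σ i = true).card with hn
  rcases Nat.mod_two_eq_zero_or_one n with h | h
  · have hn0 : (n : ZMod 2) = 0 := by
      rw [← ZMod.natCast_mod n 2, h, Nat.cast_zero]
    rw [h, hn0]
    cases b <;> decide
  · have hn1 : (n : ZMod 2) = 1 := by
      rw [← ZMod.natCast_mod n 2, h, Nat.cast_one]
    rw [h, hn1]
    cases b <;> decide

/-- The vector of `σ` solves `¬C` on the window iff `C` is false at `σ` (all forms of `C` inside
the window). -/
theorem zOf_mem_Sol_negSys_iff {N : Finset ℕ} {C : LinClause} (hC : ∀ l ∈ C, l.1 ⊆ N)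
    (σ : ℕ → Bool) : zOf N σ ∈ Sol (negSys N C) ↔ C.eval σ = false := by
  classical
  rw [mem_Sol, LinClause.eval_eq_false_iff]
  constructor
  · intro h l hl
    rcases l with ⟨f, b⟩
    have hp := h (restrictN N (linFormVec f), if b = true then 0 else 1)
      (Finset.mem_image.2 ⟨(f, b), hl, rfl⟩)
    rw [restrictN_linFormVec_dotProduct_zOf (hC _ hl) σ] at hp
    exact (linLit_eval_eq_false_iff σ f b).2 hp
  · intro h p hp
    obtain ⟨⟨f, b⟩, hl, rfl⟩ := Finset.mem_image.1 hp
    dsimp only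
    rw [restrictN_linFormVec_dotProduct_zOf (hC _ hl) σ]
    exact (linLit_eval_eq_false_iff σ f b).1 (h _ hl)

/-- If the vector of `σ` differs from the forbidden pattern of clause `i` on its (windowed) scope,
then `σ` satisfies clause `i`. -/
theorem clause_eval_of_ne_pattern {N : Finset ℕ} {φ : CNF ℕ} {i : Fin φ.length} {σ : ℕ → Bool}
    {v : ↥N} (hv : v ∈ scopeN N φ i) (hne : zOf N σ v ≠ pattern N φ i v) :
    Clause.eval σ φ[i] = true := by
  classical
  rw [scopeN, Finset.mem_subtype] at hv
  obtain ⟨b, hb⟩ := mem_clauseScope.1 hv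
  rw [Clause.eval, List.any_eq_true]
  simp only [zOf, pattern] at hne
  by_cases hpos : ((v.1, true) : Literal ℕ) ∈ φ[i]
  · rw [if_pos hpos] at hne
    have hσ : σ v.1 = true := by
      by_contra h
      rw [if_neg h] at hne
      exact hne rfl
    exact ⟨(v.1, true), hpos, by simp [Literal.eval, hσ]⟩
  · rw [if_neg hpos] at hne
    have hσ : σ v.1 = false := by
      cases h : σ v.1
      · rfl
      · rw [if_pos h] at hne
        exact absurd rfl hne
    have hbF : b = false := by
      cases b
      · rfl
      · exact absurd hb hpos
    subst hbF
    exact ⟨(v.1, false), hb, by simp [Literal.eval, hσ]⟩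

/-- Conversely, if `σ` satisfies the non-tautological clause `i` (scope inside the window), then
its vector differs from the forbidden pattern somewhere on the scope. -/
theorem exists_ne_pattern_of_clause_eval {N : Finset ℕ} {φ : CNF ℕ} {i : Fin φ.length}
    {σ : ℕ → Bool} (hsc : clauseScope φ[i] ⊆ N)
    (hnt : ¬ ∃ x, ((x, true) : Literal ℕ) ∈ φ[i] ∧ ((x, false) : Literal ℕ) ∈ φ[i])
    (h : Clause.eval σ φ[i] = true) : ∃ v ∈ scopeN N φ i, zOf N σ v ≠ pattern N φ i v := by
  classical
  rw [Clause.eval, List.any_eq_true] at h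
  obtain ⟨⟨x, b⟩, hl, hxb⟩ := h
  simp only [Literal.eval, beq_iff_eq] at hxb
  have hx : x ∈ clauseScope φ[i] := mem_clauseScope.2 ⟨b, hl⟩
  refine ⟨⟨x, hsc hx⟩, by rw [scopeN, Finset.mem_subtype]; exact hx, ?_⟩
  simp only [zOf, pattern]
  cases b
  · have hnpos : ((x, true) : Literal ℕ) ∉ φ[i] := fun hp => hnt ⟨x, hp, hl⟩
    rw [if_neg (by rw [hxb]; decide), if_neg hnpos]
    decide
  · rw [if_pos hxb, if_pos hl]
    decide

/-- The union of the windowed scopes over `F` is the windowed cover of `F`. -/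
theorem biUnion_scopeN_eq (N : Finset ℕ) (φ : CNF ℕ) (F : Finset (Fin φ.length)) :
    F.biUnion (scopeN N φ) = (cover (cnfScopes φ) F).subtype (· ∈ N) := by
  ext v
  simp only [Finset.mem_biUnion, scopeN, Finset.mem_subtype, mem_cover, cnfScopes]

/-- The forms of the windowed system `¬C` are the restrictions of the forms of `C`. -/
theorem coe_forms_negSys (N : Finset ℕ) (C : LinClause) :
    (forms (negSys N C) : Set (↥N → ZMod 2)) = restrictN N '' LinClause.forms C := by
  classical
  ext w
  simp only [forms, negSys, Finset.coe_image, Set.mem_image, Finset.mem_coe]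
  constructor
  · rintro ⟨p, ⟨l, hl, rfl⟩, rfl⟩
    exact ⟨linFormVec l.1, LinClause.mem_forms_iff.2 ⟨l, hl, rfl⟩, rfl⟩
  · rintro ⟨u, hu, rfl⟩
    obtain ⟨l, hl, rfl⟩ := LinClause.mem_forms_iff.1 hu
    exact ⟨_, ⟨l, hl, rfl⟩, rfl⟩

/-- The rank of the windowed system `¬C` is at most `rk(¬C) = linClauseRank C`. -/
theorem finrank_spanS_negSys_le (N : Finset ℕ) (C : LinClause) :
    finrank (ZMod 2) (spanS (negSys N C)) ≤ linClauseRank C := by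
  classical
  haveI : Module.Finite (ZMod 2) (Submodule.span (ZMod 2) (LinClause.forms C)) :=
    Module.Finite.span_of_finite (ZMod 2) (Set.finite_range _)
  rw [linClauseRank_eq, spanS, coe_forms_negSys, Submodule.span_image]
  exact Submodule.finrank_map_le _ _

end ResLinRank

end Summit.PneNP.PneNP.Theorems
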